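import Literature.MathematicalPhysics.QuantumLattice.HubbardModel
import HarnessLib

/-!
# Tiling the vertex set of the fermionic torus by translated blocks: embeddings and boundary counts

Topic `MathematicalPhysics/QuantumLattice` (van Hove bookkeeping for block decompositions of lattice-fermion
Hamiltonians on `Λ_N = FermionTorus 2 N = Lex (Fin 2 → Fin N)`; consumer: the thermal wedge of the Hubbard summit).
Sites carry natural coordinates `X_j = (ofLex X j : ℕ)`; the FREE-BOUNDARY (box) adjacency is the pull-back of `ℤ²`
along the coordinate map. For a block side `M ≥ 1` and `K = ⌊N/M⌋`, the `K²` blocks `c ∈ [0,K)²` are the translates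
`c·M + [0,M)²` (`|Λ_N| = N²` is the tree's `card_fermionTorus`). Everything is PROVED; no definition and no named fact:

* `exists_blockFamily` — order embeddings `f_c : Λ_M ↪o Λ_N`, `X ↦ c·M + X` (lexicographic orders), for all blocks at
  once; their ranges are the boxes (`mem_map_iff_coord`), pairwise disjoint (`blockFamily_ne`), and they intertwine the
  box adjacencies (`blockFamily_adj_iff`) and every translation-invariant pair weight (`blockFamily_weight_eq`);
* counting: every site has `≤ 4` box-neighbours (`card_filter_boxAdj_le_four`, `card_boxAdj_pairs_le`); the union of
  the blocks has `K²M²` sites and its complement `≤ 2NM` sites (`card_biUnion_blockFamily`,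
  `card_compl_biUnion_blockFamily_le`); and the **boundary count** `card_boxAdj_not_sameBlock_le`: the ordered
  box-adjacent pairs NOT inside a common block number at most `8N(2K + M + 1)` (they start at a site with a coordinate
  `≡ 0, −1 (mod M)` or `≥ KM`).

Reference: D. Ruelle, *Statistical Mechanics: Rigorous Results* (1969), §2.2 (boxes and their boundaries in the
thermodynamic limit) [cite: Ruelle1969, §2.2]. All statements are [folklore].

Re-homing note: the coordinate bookkeeping (`ext_coord`, `boxAdj_iff`, `card_filter_coord_le`,
`exists_translateEmb`, `mem_map_iff_coord`) was so far proved only inside `Summits/…/Theorems` support files of the Hubbard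
summit (`…TwSeededEnsembleEquivalenceRSourcedPressureLimitLattice`, `…WcbcsBcsConstructionTorusBoxComparison`), which a
Literature file may not import; it is elementary known mathematics about `FermionTorus` and is restated here at
Literature level so that the tiling/boundary counts below (new) are self-contained.
-/

namespace Literature.MathematicalPhysics.QuantumLattice

namespace FermionTorus

open Finset Literature.Probability.LatticeModels

/-! ### Coordinates and box adjacency -/

/-- Sites of `Λ_N` are determined by their natural coordinates. [folklore] -/
theorem ext_coord {N : ℕ} {X Y : FermionTorus 2 N} (h : ∀ j, (ofLex X j : ℕ) = (ofLex Y j : ℕ)) : X = Y := by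
  have : ofLex X = ofLex Y := funext fun j => Fin.ext (h j)
  simpa using this

/-- **Box adjacency in coordinates**: `X ∼ Y` in the pull-back of `ℤ²` iff they differ by a unit vector. [folklore] -/
theorem boxAdj_iff {N : ℕ} (x y : FermionTorus 2 N) :
    ((zdGraph 2).comap (fun x : FermionTorus 2 N => fun i : Fin 2 => ((ofLex x i : ℕ) : ℤ))).Adj x y ↔
      (((ofLex x 0 : ℕ) + 1 = ofLex y 0 ∧ (ofLex x 1 : ℕ) = ofLex y 1) ∨
       ((ofLex x 0 : ℕ) = ofLex y 0 ∧ (ofLex x 1 : ℕ) + 1 = ofLex y 1) ∨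
       ((ofLex y 0 : ℕ) + 1 = ofLex x 0 ∧ (ofLex y 1 : ℕ) = ofLex x 1) ∨
       ((ofLex y 0 : ℕ) = ofLex x 0 ∧ (ofLex y 1 : ℕ) + 1 = ofLex x 1)) := by
  rw [SimpleGraph.comap_adj, zdGraph_adj_iff, Fin.exists_fin_two]
  simp only [funext_iff, Fin.forall_fin_two, Pi.add_apply, Pi.single_eq_same,
    Pi.single_eq_of_ne (one_ne_zero (α := Fin 2)), Pi.single_eq_of_ne (zero_ne_one (α := Fin 2)), add_zero]
  constructor
  · rintro ((⟨h1, h2⟩ | ⟨h1, h2⟩) | (⟨h1, h2⟩ | ⟨h1, h2⟩)) <;> omega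
  · rintro (⟨h1, h2⟩ | ⟨h1, h2⟩ | ⟨h1, h2⟩ | ⟨h1, h2⟩) <;> omega

/-- **Every site has at most four box-neighbours.** [folklore] -/
theorem card_filter_boxAdj_le_four {N : ℕ} (x : FermionTorus 2 N) :
    (Finset.univ.filter fun y => ((zdGraph 2).comap (fun x : FermionTorus 2 N => fun i : Fin 2 => ((ofLex x i : ℕ) : ℤ))).Adj x y).card ≤ 4 := by
  calc (Finset.univ.filter fun y => ((zdGraph 2).comap (fun x : FermionTorus 2 N => fun i : Fin 2 => ((ofLex x i : ℕ) : ℤ))).Adj x y).card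
      ≤ (({((ofLex x 0 : ℕ) + 1, (ofLex x 1 : ℕ)), ((ofLex x 0 : ℕ), (ofLex x 1 : ℕ) + 1),
          ((ofLex x 0 : ℕ) - 1, (ofLex x 1 : ℕ)), ((ofLex x 0 : ℕ), (ofLex x 1 : ℕ) - 1)} : Finset (ℕ × ℕ))).card := by
        refine Finset.card_le_card_of_injOn (fun y => ((ofLex y 0 : ℕ), (ofLex y 1 : ℕ))) ?_ ?_
        · intro y hy
          rw [Finset.mem_coe, Finset.mem_filter, boxAdj_iff] at hy
          simp only [Finset.coe_insert, Finset.coe_singleton, Set.mem_insert_iff, Set.mem_singleton_iff, Prod.mk.injEq]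
          omega
        · intro y _ y' _ h
          simp only [Prod.mk.injEq] at h
          refine ext_coord fun j => ?_
          fin_cases j
          · exact h.1
          · exact h.2
    _ ≤ 4 := Finset.card_le_four

/-- The number of ordered box-adjacent pairs is at most `4N²`. [folklore] -/
theorem card_boxAdj_pairs_le (N : ℕ) :
    ((Finset.univ : Finset (FermionTorus 2 N × FermionTorus 2 N)).filter (fun z =>
      ((zdGraph 2).comap (fun x : FermionTorus 2 N => fun i : Fin 2 => ((ofLex x i : ℕ) : ℤ))).Adj z.1 z.2)).card ≤ 4 * N ^ 2 := by
  rw [Finset.card_filter, Fintype.sum_prod_type]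
  calc ∑ x : FermionTorus 2 N, ∑ y : FermionTorus 2 N, (if ((zdGraph 2).comap (fun x : FermionTorus 2 N => fun i : Fin 2 => ((ofLex x i : ℕ) : ℤ))).Adj (x, y).1 (x, y).2 then 1 else 0)
      ≤ ∑ _x : FermionTorus 2 N, 4 := Finset.sum_le_sum fun x _ => by
        rw [← Finset.card_filter]
        exact card_filter_boxAdj_le_four x
    _ = 4 * N ^ 2 := by rw [Finset.sum_const, Finset.card_univ, show Fintype.card (FermionTorus 2 N) = N ^ 2 by simp [FermionTorus, Fintype.card_lex], smul_eq_mul, mul_comm]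

/-- Along a right-fibred map into a set `B` (every fibre of `Prod.fst` on `S` has `≤ 4` elements because `S` consists of
adjacent pairs), `#S ≤ 4 · #B`. [folklore] -/
theorem card_le_four_mul_of_adj_fst {N : ℕ} (S : Finset (FermionTorus 2 N × FermionTorus 2 N))
    (B : Finset (FermionTorus 2 N))
    (hS : ∀ z ∈ S, ((zdGraph 2).comap (fun x : FermionTorus 2 N => fun i : Fin 2 => ((ofLex x i : ℕ) : ℤ))).Adj z.1 z.2 ∧ z.1 ∈ B) :
    S.card ≤ 4 * B.card := by
  have h1 : S.card ≤ 4 * (S.image Prod.fst).card := by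
    refine Finset.card_le_mul_card_image S 4 fun x _ => ?_
    calc (S.filter fun z => z.1 = x).card
        ≤ ((Finset.univ.filter fun y => ((zdGraph 2).comap (fun x : FermionTorus 2 N => fun i : Fin 2 => ((ofLex x i : ℕ) : ℤ))).Adj x y).map
            ⟨fun y => (x, y), fun y y' h => (Prod.mk.injEq _ _ _ _ ▸ h).2⟩).card := by
          refine Finset.card_le_card fun z hz => ?_
          rw [Finset.mem_filter] at hz
          rw [Finset.mem_map]
          refine ⟨z.2, Finset.mem_filter.2 ⟨Finset.mem_univ _, ?_⟩, ?_⟩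
          · rw [← hz.2]; exact (hS z hz.1).1
          · exact Prod.ext hz.2.symm rfl
      _ ≤ 4 := by rw [Finset.card_map]; exact card_filter_boxAdj_le_four x
  have h2 : (S.image Prod.fst).card ≤ B.card :=
    Finset.card_le_card fun x hx => by
      obtain ⟨z, hz, rfl⟩ := Finset.mem_image.1 hx
      exact (hS z hz).2
  omega

/-! ### Counting sites by one coordinate -/

/-- `#{X ∈ Λ_N | P(X_i)} ≤ #{a < N | P a} · N`. [folklore] -/
theorem card_filter_coord_le (N : ℕ) (i : Fin 2) (P : ℕ → Prop) [DecidablePred P] :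
    (Finset.univ.filter fun X : FermionTorus 2 N => P (ofLex X i : ℕ)).card ≤
      (Finset.univ.filter fun a : Fin N => P (a : ℕ)).card * N := by
  have key : (Finset.univ.filter fun X : FermionTorus 2 N => P (ofLex X i : ℕ)).card ≤
      ((Finset.univ.filter fun a : Fin N => P (a : ℕ)) ×ˢ (Finset.univ : Finset (Fin N))).card := by
    refine Finset.card_le_card_of_injOn (fun X => (ofLex X i, ofLex X (i + 1))) (fun X hX => ?_) (fun X _ X' _ hXX' => ?_)
    · rw [Finset.coe_filter] at hX
      simp only [Finset.coe_product, Finset.coe_filter, Finset.coe_univ, Set.mem_prod, Set.mem_setOf_eq, Set.mem_univ, and_true]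
      exact ⟨Finset.mem_univ _, hX.2⟩
    · simp only [Prod.mk.injEq] at hXX'
      refine ext_coord fun j => ?_
      by_cases hj : j = i
      · subst hj; rw [hXX'.1]
      · have : j = i + 1 := by omega
        subst this; rw [hXX'.2]
  refine key.trans ?_
  rw [Finset.card_product, Finset.card_univ, Fintype.card_fin]

/-- `#{a < N | M ∣ a + 1} ≤ N / M`. [folklore] -/
theorem card_filter_dvd_succ_le (N M : ℕ) :
    (Finset.univ.filter fun a : Fin N => M ∣ (a : ℕ) + 1).card ≤ N / M := by
  have key : (Finset.univ.filter fun a : Fin N => M ∣ (a : ℕ) + 1).card ≤ (Finset.Ioc 0 (N / M)).card := by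
    refine Finset.card_le_card_of_injOn (fun a => ((a : ℕ) + 1) / M) (fun a ha => ?_) (fun a ha a' ha' h => ?_)
    · rw [Finset.coe_filter] at ha
      obtain ⟨q, hq⟩ := ha.2
      rw [Finset.coe_Ioc, Set.mem_Ioc]
      have hle : (a : ℕ) + 1 ≤ N := a.isLt
      refine ⟨Nat.div_pos (Nat.le_of_dvd (Nat.succ_pos _) ⟨q, hq⟩) ?_, Nat.div_le_div_right hle⟩
      rcases Nat.eq_zero_or_pos M with hM | hM
      · rw [hM, zero_mul] at hq; omega
      · exact hM
    · rw [Finset.coe_filter] at ha ha'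
      have e1 := Nat.div_mul_cancel ha.2
      have e2 := Nat.div_mul_cancel ha'.2
      simp only at h
      apply Fin.ext
      have : (a : ℕ) + 1 = (a' : ℕ) + 1 := by rw [← e1, ← e2, h]
      omega
  simpa using key

/-- `#{a < N | M ∣ a} ≤ N / M + 1`. [folklore] -/
theorem card_filter_dvd_le (N M : ℕ) :
    (Finset.univ.filter fun a : Fin N => M ∣ (a : ℕ)).card ≤ N / M + 1 := by
  have key : (Finset.univ.filter fun a : Fin N => M ∣ (a : ℕ)).card ≤ (Finset.range (N / M + 1)).card := by
    refine Finset.card_le_card_of_injOn (fun a => (a : ℕ) / M) (fun a _ => ?_) (fun a ha a' ha' h => ?_)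
    · rw [Finset.coe_range, Set.mem_Iio, Nat.lt_succ_iff]
      exact Nat.div_le_div_right a.isLt.le
    · rw [Finset.coe_filter] at ha ha'
      apply Fin.ext
      rw [← Nat.div_mul_cancel ha.2, ← Nat.div_mul_cancel ha'.2]
      simp only at h
      rw [h]
  simpa using key

/-- `#{a < N | K M ≤ a} ≤ N - K M`. [folklore] -/
theorem card_filter_ge_le (N T : ℕ) :
    (Finset.univ.filter fun a : Fin N => T ≤ (a : ℕ)).card ≤ N - T := by
  have key : (Finset.univ.filter fun a : Fin N => T ≤ (a : ℕ)).card ≤ (Finset.range (N - T)).card := by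
    refine Finset.card_le_card_of_injOn (fun a => (a : ℕ) - T) (fun a ha => ?_) (fun a ha a' ha' h => ?_)
    · rw [Finset.coe_filter] at ha
      rw [Finset.coe_range, Set.mem_Iio]
      have h1 := a.isLt
      have h2 := ha.2
      show (a : ℕ) - T < N - T
      omega
    · rw [Finset.coe_filter] at ha ha'
      have h2 := ha.2
      have h2' := ha'.2
      apply Fin.ext
      simp only at h
      omega
  simpa using key

/-! ### The family of block embeddings -/

/-- **Block embeddings.** For offsets `p` with `p_j + M ≤ N` there is an order embedding `f : Λ_M ↪o Λ_N` (lexicographic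
orders) acting as the translation `X ↦ p + X` on coordinates. [folklore] -/
theorem exists_translateEmb {M N : ℕ} (p : Fin 2 → ℕ) (hp : ∀ j, p j + M ≤ N) :
    ∃ f : FermionTorus 2 M ↪o FermionTorus 2 N, ∀ X j, (ofLex (f X) j : ℕ) = p j + (ofLex X j : ℕ) := by
  let g : FermionTorus 2 M → FermionTorus 2 N := fun X =>
    toLex fun j => ⟨p j + (ofLex X j : ℕ), by have := (ofLex X j).isLt; have := hp j; omega⟩
  have hg : ∀ X j, (ofLex (g X) j : ℕ) = p j + (ofLex X j : ℕ) := fun X j => rfl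
  have hmono : StrictMono g := by
    intro X Y hXY
    obtain ⟨i, hi, hlt⟩ := hXY
    refine ⟨i, fun j hj => ?_, ?_⟩
    · have := hi j hj
      apply Fin.ext
      change p j + (ofLex X j : ℕ) = p j + (ofLex Y j : ℕ)
      rw [show ofLex X j = ofLex Y j from this]
    · change (⟨p i + (ofLex X i : ℕ), _⟩ : Fin N) < ⟨p i + (ofLex Y i : ℕ), _⟩
      rw [Fin.mk_lt_mk]
      have : (ofLex X i : ℕ) < (ofLex Y i : ℕ) := hlt
      omega
  exact ⟨OrderEmbedding.ofStrictMono g hmono, hg⟩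

/-- **The family of block embeddings**: for `1 ≤ M ≤ N` and `K = ⌊N/M⌋` there are order embeddings
`f_c : Λ_M ↪o Λ_N`, `X ↦ (c₀M, c₁M) + X`, for all blocks `c ∈ [0,K)²` at once. [folklore] -/
theorem exists_blockFamily (N M : ℕ) (hMN : M ≤ N) :
    ∃ f : ℕ × ℕ → (FermionTorus 2 M ↪o FermionTorus 2 N),
      ∀ c ∈ Finset.range (N / M) ×ˢ Finset.range (N / M), ∀ X j, (ofLex (f c X) j : ℕ) = ![c.1 * M, c.2 * M] j + (ofLex X j : ℕ) := by
  have h0 : ∀ j : Fin 2, (fun _ : Fin 2 => (0 : ℕ)) j + M ≤ N := fun _ => by simpa using hMN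
  obtain ⟨f₀, -⟩ := exists_translateEmb (fun _ : Fin 2 => (0 : ℕ)) h0
  have hex : ∀ c : ℕ × ℕ, ∃ f : FermionTorus 2 M ↪o FermionTorus 2 N, c ∈ Finset.range (N / M) ×ˢ Finset.range (N / M) →
      ∀ X j, (ofLex (f X) j : ℕ) = ![c.1 * M, c.2 * M] j + (ofLex X j : ℕ) := by
    intro c
    by_cases hc : c ∈ Finset.range (N / M) ×ˢ Finset.range (N / M)
    · have hp : ∀ j : Fin 2, ![c.1 * M, c.2 * M] j + M ≤ N := by
        rw [Finset.mem_product, Finset.mem_range, Finset.mem_range] at hc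
        have hKM : N / M * M ≤ N := Nat.div_mul_le_self N M
        have h1 : c.1 * M + M ≤ N := by nlinarith [hc.1]
        have h2 : c.2 * M + M ≤ N := by nlinarith [hc.2]
        intro j
        fin_cases j
        · simpa using h1
        · simpa using h2
      obtain ⟨f, hf⟩ := exists_translateEmb _ hp
      exact ⟨f, fun _ => hf⟩
    · exact ⟨f₀, fun h => absurd h hc⟩
  choose f hf using hex
  exact ⟨f, fun c hc => hf c hc⟩

/-- **The range of a block embedding is the box `p + [0, M)²`.** [folklore] -/
theorem mem_map_iff_coord {M N : ℕ} {p : Fin 2 → ℕ} {f : FermionTorus 2 M ↪o FermionTorus 2 N}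
    (hf : ∀ X j, (ofLex (f X) j : ℕ) = p j + (ofLex X j : ℕ)) (X' : FermionTorus 2 N) :
    X' ∈ (Finset.univ : Finset (FermionTorus 2 M)).map f.toEmbedding ↔
      ∀ j, p j ≤ (ofLex X' j : ℕ) ∧ (ofLex X' j : ℕ) < p j + M := by
  constructor
  · intro h
    obtain ⟨X, -, rfl⟩ := Finset.mem_map.1 h
    intro j
    have h1 := hf X j
    have h2 := (ofLex X j).isLt
    change p j ≤ (ofLex (f X) j : ℕ) ∧ (ofLex (f X) j : ℕ) < p j + M
    omega
  · intro h
    refine Finset.mem_map.2 ⟨toLex fun j => ⟨(ofLex X' j : ℕ) - p j, by have := h j; omega⟩, Finset.mem_univ _, ?_⟩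
    refine ext_coord fun j => ?_
    change (ofLex (f _) j : ℕ) = _
    rw [hf]
    change p j + ((ofLex X' j : ℕ) - p j) = (ofLex X' j : ℕ)
    have := h j
    omega

/-- **Distinct blocks have disjoint ranges** (block embeddings with offsets `cM ≠ c'M`). [folklore] -/
theorem blockFamily_ne {M N : ℕ} (hM : 0 < M) {f : ℕ × ℕ → (FermionTorus 2 M ↪o FermionTorus 2 N)}
    {T : Finset (ℕ × ℕ)} (hf : ∀ c ∈ T, ∀ X j, (ofLex (f c X) j : ℕ) = ![c.1 * M, c.2 * M] j + (ofLex X j : ℕ)) :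
    ∀ c ∈ T, ∀ c' ∈ T, c ≠ c' → ∀ X Y, f c X ≠ f c' Y := by
  intro c hc c' hc' hne X Y heq
  apply hne
  have h0 := hf c hc X 0; have h0' := hf c' hc' Y 0
  have h1 := hf c hc X 1; have h1' := hf c' hc' Y 1
  simp only [Matrix.cons_val_zero, Matrix.cons_val_one] at h0 h0' h1 h1'
  rw [heq] at h0 h1
  have hX0 := (ofLex X 0).isLt; have hY0 := (ofLex Y 0).isLt
  have hX1 := (ofLex X 1).isLt; have hY1 := (ofLex Y 1).isLt
  have e0 : c.1 = c'.1 := by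
    have := congrArg (· / M) (h0.symm.trans h0')
    simp only [Nat.mul_comm _ M] at this
    rwa [Nat.mul_add_div hM, Nat.mul_add_div hM, Nat.div_eq_of_lt hX0, Nat.div_eq_of_lt hY0] at this
  have e1 : c.2 = c'.2 := by
    have := congrArg (· / M) (h1.symm.trans h1')
    simp only [Nat.mul_comm _ M] at this
    rwa [Nat.mul_add_div hM, Nat.mul_add_div hM, Nat.div_eq_of_lt hX1, Nat.div_eq_of_lt hY1] at this
  exact Prod.ext e0 e1

/-- **Block embeddings intertwine the box adjacencies.** [folklore] -/
theorem blockFamily_adj_iff {M N : ℕ} {p : Fin 2 → ℕ} {f : FermionTorus 2 M ↪o FermionTorus 2 N}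
    (hf : ∀ X j, (ofLex (f X) j : ℕ) = p j + (ofLex X j : ℕ)) (X Y : FermionTorus 2 M) :
    ((zdGraph 2).comap (fun x : FermionTorus 2 M => fun i : Fin 2 => ((ofLex x i : ℕ) : ℤ))).Adj X Y ↔
      ((zdGraph 2).comap (fun x : FermionTorus 2 N => fun i : Fin 2 => ((ofLex x i : ℕ) : ℤ))).Adj (f X) (f Y) := by
  rw [boxAdj_iff, boxAdj_iff, hf, hf, hf, hf]
  omega

/-- **Block embeddings preserve coordinate differences**, hence every translation-invariant pair weight
`w(x, y) = ω(y − x)`. [folklore] -/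
theorem blockFamily_weight_eq {M N : ℕ} {p : Fin 2 → ℕ} {f : FermionTorus 2 M ↪o FermionTorus 2 N}
    (hf : ∀ X j, (ofLex (f X) j : ℕ) = p j + (ofLex X j : ℕ)) {α : Type*} (ω : (Fin 2 → ℤ) → α)
    (z : FermionTorus 2 M × FermionTorus 2 M) :
    (fun z : FermionTorus 2 M × FermionTorus 2 M => ω ((fun i : Fin 2 => ((ofLex z.2 i : ℕ) : ℤ)) - (fun i : Fin 2 => ((ofLex z.1 i : ℕ) : ℤ)))) z =
      (fun z : FermionTorus 2 N × FermionTorus 2 N => ω ((fun i : Fin 2 => ((ofLex z.2 i : ℕ) : ℤ)) - (fun i : Fin 2 => ((ofLex z.1 i : ℕ) : ℤ)))) (Prod.map f f z) := by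
  simp only [Prod.map]
  congr 1
  funext i
  simp only [Pi.sub_apply, hf]
  push_cast
  ring

/-! ### Cardinalities of the tiling -/

/-- The blocks `[0,K)²` number `K²`. [folklore] -/
theorem card_blocks (K : ℕ) : (Finset.range K ×ˢ Finset.range K).card = K ^ 2 := by
  rw [Finset.card_product, Finset.card_range, sq]

/-- **The union of the blocks has `K² M²` sites.** [folklore] -/
theorem card_biUnion_blockFamily {M N : ℕ} (hM : 0 < M) {f : ℕ × ℕ → (FermionTorus 2 M ↪o FermionTorus 2 N)}
    {T : Finset (ℕ × ℕ)} (hf : ∀ c ∈ T, ∀ X j, (ofLex (f c X) j : ℕ) = ![c.1 * M, c.2 * M] j + (ofLex X j : ℕ)) :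
    (T.biUnion fun c => (Finset.univ : Finset (FermionTorus 2 M)).map (f c).toEmbedding).card = T.card * M ^ 2 := by
  rw [Finset.card_biUnion]
  · simp only [Finset.card_map, Finset.card_univ, show Fintype.card (FermionTorus 2 M) = M ^ 2 by simp [FermionTorus, Fintype.card_lex], Finset.sum_const, smul_eq_mul]
  · intro c hc c' hc' hne
    rw [Function.onFun, Finset.disjoint_left]
    intro x hx hx'
    obtain ⟨a, _, rfl⟩ := Finset.mem_map.1 hx
    obtain ⟨b, _, hb⟩ := Finset.mem_map.1 hx'
    exact blockFamily_ne hM hf c hc c' hc' hne a b hb.symm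

/-- **The complement of the blocks is thin**: `#(⋃_c f_c Λ_M)ᶜ ≤ 2NM` for `K = ⌊N/M⌋` blocks per row. [folklore] -/
theorem card_compl_biUnion_blockFamily_le {M N : ℕ} (hM : 0 < M) {f : ℕ × ℕ → (FermionTorus 2 M ↪o FermionTorus 2 N)}
    (hf : ∀ c ∈ Finset.range (N / M) ×ˢ Finset.range (N / M), ∀ X j, (ofLex (f c X) j : ℕ) = ![c.1 * M, c.2 * M] j + (ofLex X j : ℕ)) :
    ((Finset.range (N / M) ×ˢ Finset.range (N / M)).biUnion fun c =>
        (Finset.univ : Finset (FermionTorus 2 M)).map (f c).toEmbedding)ᶜ.card ≤ 2 * N * M := by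
  rw [Finset.card_compl, card_biUnion_blockFamily hM hf, card_blocks, show Fintype.card (FermionTorus 2 N) = N ^ 2 by simp [FermionTorus, Fintype.card_lex]]
  have h1 : N / M * M ≤ N := Nat.div_mul_le_self N M
  have h2 : N < N / M * M + M := Nat.lt_div_mul_add hM
  have h3 : N ^ 2 - (N / M) ^ 2 * M ^ 2 = (N - N / M * M) * (N + N / M * M) := by
    rw [← mul_pow, Nat.sq_sub_sq, mul_comm]
  rw [h3]
  have h4 : N - N / M * M ≤ M := by omega
  calc (N - N / M * M) * (N + N / M * M) ≤ M * (N + N) := Nat.mul_le_mul h4 (by omega)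
    _ = 2 * N * M := by ring

/-! ### The boundary count -/

/-- **Interior sites stay in their block**: if no coordinate of `x` is `≡ −1` or `≡ 0 (mod M)` or `≥ KM`, then every
box-neighbour `y` of `x` lies in the same block `c = (x₀/M, x₁/M) ∈ [0,K)²` as `x`. [folklore] -/
theorem sameBlock_of_interior {M N K : ℕ} (hM : 0 < M) {f : ℕ × ℕ → (FermionTorus 2 M ↪o FermionTorus 2 N)}
    (hf : ∀ c ∈ Finset.range K ×ˢ Finset.range K, ∀ X j, (ofLex (f c X) j : ℕ) = ![c.1 * M, c.2 * M] j + (ofLex X j : ℕ))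
    {x y : FermionTorus 2 N}
    (hadj : ((zdGraph 2).comap (fun x : FermionTorus 2 N => fun i : Fin 2 => ((ofLex x i : ℕ) : ℤ))).Adj x y)
    (hx : ∀ i : Fin 2, ¬ (M ∣ (ofLex x i : ℕ) + 1) ∧ ¬ (M ∣ (ofLex x i : ℕ)) ∧ (ofLex x i : ℕ) < K * M) :
    ∃ c ∈ Finset.range K ×ˢ Finset.range K,
      x ∈ (Finset.univ : Finset (FermionTorus 2 M)).map (f c).toEmbedding ∧
        y ∈ (Finset.univ : Finset (FermionTorus 2 M)).map (f c).toEmbedding := by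
  set c : ℕ × ℕ := ((ofLex x 0 : ℕ) / M, (ofLex x 1 : ℕ) / M) with hc
  have hcK : c ∈ Finset.range K ×ˢ Finset.range K := by
    rw [Finset.mem_product, Finset.mem_range, Finset.mem_range]
    exact ⟨Nat.div_lt_of_lt_mul (by rw [mul_comm]; exact (hx 0).2.2), Nat.div_lt_of_lt_mul (by rw [mul_comm]; exact (hx 1).2.2)⟩
  refine ⟨c, hcK, ?_, ?_⟩
  · rw [mem_map_iff_coord (hf c hcK)]
    intro j
    fin_cases j
    · simp only [Fin.zero_eta, Matrix.cons_val_zero]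
      exact ⟨Nat.div_mul_le_self _ _, by rw [hc]; exact Nat.lt_div_mul_add hM⟩
    · simp only [Fin.mk_one, Matrix.cons_val_one, Matrix.cons_val_zero]
      exact ⟨Nat.div_mul_le_self _ _, by rw [hc]; exact Nat.lt_div_mul_add hM⟩
  · rw [mem_map_iff_coord (hf c hcK)]
    -- a step that does not cross a multiple of `M` keeps the block index
    have key : ∀ a b : ℕ, ¬ (M ∣ a + 1) → ¬ (M ∣ a) → (a + 1 = b ∨ a = b ∨ b + 1 = a) →
        a / M * M ≤ b ∧ b < a / M * M + M := by
      intro a b h1 h2 hab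
      have ha1 : a / M * M ≤ a := Nat.div_mul_le_self a M
      have ha2 : a < a / M * M + M := Nat.lt_div_mul_add hM
      rcases hab with hab | hab | hab
      · refine ⟨by omega, ?_⟩
        by_contra hlt
        have heq : b = a / M * M + M := by omega
        exact h1 ⟨a / M + 1, by rw [hab, heq]; ring⟩
      · subst hab; exact ⟨ha1, ha2⟩
      · refine ⟨?_, by omega⟩
        by_contra hlt
        have heq : a = a / M * M := by omega
        exact h2 ⟨a / M, by rw [mul_comm]; exact heq⟩
    rw [boxAdj_iff] at hadj
    intro j
    fin_cases j
    · simp only [Fin.zero_eta, Matrix.cons_val_zero]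
      exact key _ _ (hx 0).1 (hx 0).2.1 (by omega)
    · simp only [Fin.mk_one, Matrix.cons_val_one, Matrix.cons_val_zero]
      exact key _ _ (hx 1).1 (hx 1).2.1 (by omega)

/-- **The boundary count**: for `K = ⌊N/M⌋` and block embeddings `f_c`, the ordered box-adjacent pairs of `Λ_N` NOT
inside a common block `f_c(Λ_M × Λ_M)` number at most `8N(2K + M + 1)`. [folklore] -/
theorem card_boxAdj_not_sameBlock_le {M N : ℕ} (hM : 0 < M) {f : ℕ × ℕ → (FermionTorus 2 M ↪o FermionTorus 2 N)}
    (hf : ∀ c ∈ Finset.range (N / M) ×ˢ Finset.range (N / M), ∀ X j, (ofLex (f c X) j : ℕ) = ![c.1 * M, c.2 * M] j + (ofLex X j : ℕ)) :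
    ((((Finset.range (N / M) ×ˢ Finset.range (N / M)).biUnion fun c =>
        (Finset.univ : Finset (FermionTorus 2 M × FermionTorus 2 M)).map
          ⟨Prod.map (f c) (f c), (f c).injective.prodMap (f c).injective⟩)ᶜ).filter fun z =>
        ((zdGraph 2).comap (fun x : FermionTorus 2 N => fun i : Fin 2 => ((ofLex x i : ℕ) : ℤ))).Adj z.1 z.2).card ≤
      8 * N * (2 * (N / M) + M + 1) := by
  -- the bad sites: a coordinate `≡ -1, 0 (mod M)` or `≥ KM`, `K = ⌊N/M⌋`
  set B : Finset (FermionTorus 2 N) := Finset.univ.filter fun x =>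
    ∃ i : Fin 2, M ∣ (ofLex x i : ℕ) + 1 ∨ M ∣ (ofLex x i : ℕ) ∨ N / M * M ≤ (ofLex x i : ℕ) with hB
  have hstart : ∀ z ∈ (((Finset.range (N / M) ×ˢ Finset.range (N / M)).biUnion fun c =>
      (Finset.univ : Finset (FermionTorus 2 M × FermionTorus 2 M)).map
        ⟨Prod.map (f c) (f c), (f c).injective.prodMap (f c).injective⟩)ᶜ).filter fun z =>
        ((zdGraph 2).comap (fun x : FermionTorus 2 N => fun i : Fin 2 => ((ofLex x i : ℕ) : ℤ))).Adj z.1 z.2,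
      ((zdGraph 2).comap (fun x : FermionTorus 2 N => fun i : Fin 2 => ((ofLex x i : ℕ) : ℤ))).Adj z.1 z.2 ∧ z.1 ∈ B := by
    intro z hz
    rw [Finset.mem_filter, Finset.mem_compl, Finset.mem_biUnion, not_exists] at hz
    refine ⟨hz.2, ?_⟩
    rw [hB, Finset.mem_filter]
    refine ⟨Finset.mem_univ _, ?_⟩
    by_contra hgood
    simp only [not_exists, not_or, not_le] at hgood
    obtain ⟨c, hc, hx, hy⟩ := sameBlock_of_interior hM hf hz.2 (fun i => ⟨(hgood i).1, (hgood i).2.1, (hgood i).2.2⟩)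
    refine hz.1 c ⟨hc, ?_⟩
    obtain ⟨a, -, ha⟩ := Finset.mem_map.1 hx
    obtain ⟨b, -, hb⟩ := Finset.mem_map.1 hy
    exact Finset.mem_map.2 ⟨(a, b), Finset.mem_univ _, Prod.ext ha hb⟩
  refine (card_le_four_mul_of_adj_fst _ B hstart).trans ?_
  -- counting the bad sites coordinate by coordinate
  have hBle : B.card ≤ 2 * (N * (2 * (N / M) + M + 1)) := by
    have hsub : B ⊆ (Finset.univ.filter fun x : FermionTorus 2 N => M ∣ (ofLex x 0 : ℕ) + 1 ∨ M ∣ (ofLex x 0 : ℕ) ∨ N / M * M ≤ (ofLex x 0 : ℕ)) ∪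
        (Finset.univ.filter fun x : FermionTorus 2 N => M ∣ (ofLex x 1 : ℕ) + 1 ∨ M ∣ (ofLex x 1 : ℕ) ∨ N / M * M ≤ (ofLex x 1 : ℕ)) := by
      intro x hx
      rw [hB, Finset.mem_filter, Fin.exists_fin_two] at hx
      rw [Finset.mem_union, Finset.mem_filter, Finset.mem_filter]
      tauto
    have hcoord : ∀ i : Fin 2, (Finset.univ.filter fun x : FermionTorus 2 N =>
        M ∣ (ofLex x i : ℕ) + 1 ∨ M ∣ (ofLex x i : ℕ) ∨ N / M * M ≤ (ofLex x i : ℕ)).card ≤ N * (2 * (N / M) + M + 1) := by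
      intro i
      refine (card_filter_coord_le N i (fun a => M ∣ a + 1 ∨ M ∣ a ∨ N / M * M ≤ a)).trans ?_
      rw [mul_comm]
      refine Nat.mul_le_mul_left N ?_
      have h1 := card_filter_dvd_succ_le N M
      have h2 := card_filter_dvd_le N M
      have h3 := card_filter_ge_le N (N / M * M)
      have h4 : N - N / M * M ≤ M := by
        have := Nat.lt_div_mul_add (a := N) hM
        omega
      calc (Finset.univ.filter fun a : Fin N => M ∣ (a : ℕ) + 1 ∨ M ∣ (a : ℕ) ∨ N / M * M ≤ (a : ℕ)).card
          ≤ ((Finset.univ.filter fun a : Fin N => M ∣ (a : ℕ) + 1) ∪ (Finset.univ.filter fun a : Fin N => M ∣ (a : ℕ)) ∪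
              (Finset.univ.filter fun a : Fin N => N / M * M ≤ (a : ℕ))).card := by
            refine Finset.card_le_card fun a ha => ?_
            rw [Finset.mem_filter] at ha
            simp only [Finset.mem_union, Finset.mem_filter, Finset.mem_univ, true_and]
            tauto
        _ ≤ N / M + (N / M + 1) + (N - N / M * M) :=
            (Finset.card_union_le _ _).trans (add_le_add ((Finset.card_union_le _ _).trans (add_le_add h1 h2)) h3)
        _ ≤ 2 * (N / M) + M + 1 := by omega
    calc B.card ≤ _ := Finset.card_le_card hsub
      _ ≤ _ := Finset.card_union_le _ _
      _ ≤ N * (2 * (N / M) + M + 1) + N * (2 * (N / M) + M + 1) := add_le_add (hcoord 0) (hcoord 1)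
      _ = 2 * (N * (2 * (N / M) + M + 1)) := by ring
  calc 4 * B.card ≤ 4 * (2 * (N * (2 * (N / M) + M + 1))) := Nat.mul_le_mul_left 4 hBle
    _ = 8 * N * (2 * (N / M) + M + 1) := by ring

end FermionTorus

end Literature.MathematicalPhysics.QuantumLattice
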